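import Summits.QuantumFields.BalabanUV.T4Continuum.Spine.NE1p.DressedSmallFieldInnerLabelsRefined
import Summits.QuantumFields.BalabanUV.T4Continuum.Spine.NE1p.DressedSmallFieldInnerLabelsWitness
import Summits.QuantumFields.BalabanUV.T4Continuum.Spine.NE1p.DressedSmallFieldNestedToriWitness

/-!
# T⁴ programme, spine estimate NE1′ (node O3b/H2) — WITNESS «THE JUNCTION FIRES ON A DECIDED TWO-TORUS DATUM — AND THE REFINEMENT
# COSTS DECAY»: S48's `attachedPart_locE_le_of_coresAt_pencil_innerLabels_refined` (N0u's inner-label END on pv22's NESTED tori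
# `(N, L·N)`, `foot := trefineDom L N`, `hmono` and the (2.27)∘(2.32) link SUPPLIED — the junction S40 × S43) APPLIED ONCE BY NAME — a
# decided applier — on ONE covered inner label living on the REFINED unit block of the FINE torus; for `3 ≤ L` the junction's `hmono` is
# STRICT on the datum (S47 BY NAME) and the label is STRICTLY LIGHTER than the same label read on one torus

Cell `pub-balaban`, sub-cell `t4`, row NE1′ formalisation crew (`t4/formal/NE1p/LEAVES.md` row W71 ∕ DAG N29zzzz; INTENT + STAGED `HOME/CLAIMS.log`
l.22286, BOOKED typer gen 8 R-T138 l.22332; X202 its read), unit `b2b-balaban-t4-ne1p-formalise-leaf-06` (gen 12); PART 1 of 2 (D1).  ADDITIVE — imports S48 `Spine/NE1p/DressedSmallFieldInnerLabelsRefined` (leaf-05 g11, p236869; → S40.1, S43.1 `Support/TorusBlockRefinement`,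
the owner's N0u), W50.1 `Spine/NE1p/DressedSmallFieldInnerLabelsWitness` (leaf-06 g11; → W45 ∕ W41 ∕ W35 ∕ W33 ∕ W24, row NE5's toy frame) and W59.1
`Spine/NE1p/DressedSmallFieldNestedToriWitness` (leaf-10 g11, p237070; → S44, S47 `Support/TorusBlockRefinementCard`, W53.1 — imported for its located
smallness clause `hsmall_N` and S47's lemmas BY NAME) ONLY — all LANDED; toy DATA `def`s + theorems; 0 `def … : Prop`, 0 cite, 0 sorry, 0
`attribute`; nothing of S48 ∕ S47 ∕ S43 ∕ S40 ∕ N0u ∕ W59 ∕ W50 ∕ W45 ∕ W41 ∕ W35 ∕ W33 ∕ W24 ∕ pv22 is restated — their declarations are used BY NAME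
(`attachedPart_locE_le_of_coresAt_pencil_innerLabels_refined`, `trefineDom`, `torusTreeLen_lt_trefine_singleton`, `torusTreeLen_trefine_singleton_ge`,
`card_trefine_singleton`, `hsmall_N`, `hκ_F`, `h229_F`, `budget_half`, `termAt_coreW_pencil`, `closedForm_real_sub_zero`, `norm_term_le`, `letterMass_coreW`, `coreW`,
`hrate_torus_num`, `exp_locE_cube`, `torus_consts`, `K₀_four`, …).

WHY.  S48 (leaf-05 g11) joined the crew's two nested-tori constructions in ONE END — N0u's inner-label END with `foot := trefineDom L N`
and `hmono := torusTreeLen_le_trefine` (S43.1, [Dimock2013] Lemma 10 BY NAME) and the link of S40.1 at the fine torus's unit cubes: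
the inner labels `⟨W, (𝐃, P)⟩` of a coarse polymer `Z` live on its REFINED footprint `(trefineDom L N Z).1`.  Its END (TREE
`Spine/NE1p/DressedSmallFieldInnerLabelsRefined.lean`, the file's one theorem) has NO applier in `Spine/NE1p` (grep at this file's
INTENT); every decided inner-label witness of the crew (W50; W24 ∕ W45's families) reads ONE torus (`foot := id`) — exactly where the
typer's strict-refinement test (R-T126 ∕ X160 «R5») is REFUTED and where S47 showed it PASSES for `foot := trefineDom`.  Here:
* §1 OUR located numerals: the count rate `RR := 2·(64 log 162) + 3` and the bond letter `sR := e^{−(5RR+1)}∕64`, with N0u's rate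
  bookkeeping `hRR` met WITH EQUALITY (`64·(e^{5RR}·sR·e^{1·1}) = 1`), W45's `hκ_F` ∕ `h229_F` moved to S48's located letter by
  `torus_consts` ∕ `K₀_four` (read at the torus `N = 1` — pv22's constants do not depend on `N`; the amplitude clause inline, the same statement
  being W69's `h229k_I`), the smallness clause = W59's `hsmall_N` BY NAME;
* §2 THE DATUM: the coarse unit cube `X₀` and its REFINED block `blk := trefineDom L N X₀` of the fine torus (`L⁴` cubes, S47's
  `card_trefine_singleton`); ONE inner label `lab := ⟨∅, ({blk}, ∅)⟩` — no uncovered cube, the block covered by ITSELF as one fine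
  localization domain, no bond — as the ONLY term, at `X₀` only (`termsR`); S48's `hadm` MET (`hadm_R`: the singleton family covers
  the refined footprint, `mem_coveringFamilies`);
* §3 the label-indexed cores (toy DATA): W33's one-label core at the weight `(cM r∕2)·majR l`, `majR` S48's majorant SHAPE BY
  CHOICE, so `hAmp_R` holds by W41's `budget_half`; at the datum `majR lab = α₆F·e^{−δFκF·d_B}·e^{−RR(d_B+5)}`, `d_B :=
  torusTreeLen blk.1` — the FINE tree length of the refined block enters the weight;
* §4 **`junctionEnd_fires`** — S48's END ONCE BY NAME for every `N`, `L`; conclusion LITERAL; closed form `≤ K₀(64,8)`;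
* PART 2 (`…InnerLabelsRefinedWitnessLive`, imports THIS file only) LOCATED ∕ GENUINE: `hmono_strict` — for `3 ≤ L`,
  `torusTreeLen X₀.1 = 0 < torusTreeLen blk.1` (S47 BY NAME: the junction's `hmono` is STRICT on the datum); `majR_lab_lt_oneTorus` —
  the label is STRICTLY LIGHTER than the same covered label read on one torus: the refinement COSTS decay; `actR_X₀` closed form,
  `actR_live`, `junctionEnd_live` (W24's `exp_locE_cube` BY NAME).

HONEST FRAMING.  A DECIDED TOY ([folklore]; 0 sorry; 0 citations; no `def … : Prop` — the `def`s are toy DATA and two numerals): ONE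
term on ONE polymer — a vacuity-and-strictness check of S48's junction END, nothing more; the core is a THEOREM-backed instance of the
cell's typed FORMAT of (2.14) over row NE5's TOY frame — NOT Bałaban's (2.14) terms; «the refined block covered by itself, no bond, no
uncovered cube» is OUR toy choice ((B1b) NOT claimed: Bałaban's terms of `Z` are NOT shown to be these labels); (B3-amp) MET because the
weight is CHOSEN as S48's majorant — UNPRINTED for Bałaban's cores (GAPS G-ne9p2-5); WHICH pair `(N, L·N)` is Bałaban's `(𝐃_{k+1},
𝐃_k)` and `L` his integer stay pv22's READING (D-pv22.3) — `3 ≤ L` is S47's∕pv22's hypothesis letter, print's «L odd > 11» TYPE only;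
`RR`, `sR`, `½`, `A∕4` are OUR numerals over pv22's located `64 log 162`, `K₀(64,8)`, `64`, `9`; print's (2.27)–(2.34), (2.36),
`e^{−(κ₁−1)}` are S48's DISPLAYED KIND, TYPE∕CONTEXT only — no numeral of [Balaban1988RGII] ∕ [Dimock2013] asserted as a fact about
Bałaban's densities; 0 binders instantiated on Bałaban's densities; no wall item; wall v1.8 (T4-DAG v48) does NOT move; R-t4r2-Q2 NOT
met thereby; NE1′ ⇐ the named binders — NOT proved, NOT printed; spine PROVED 0∕9; count 9 unchanged.  Rung (B)+1 on ONE finite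
four-torus — NOT infinite volume, NOT a mass gap, NOT OS on ℝ⁴, NOT Clay.
HONEST DEPENDENCY: continuum YM on T⁴ ⇐ BetaPertH ∧ nine spine estimates (0/9 proved); BetaPertH ⇐ (D1) ∧ (D4) ∧ CAP+tail; G-an2-4
gates asym, D1 and NE2/3/4.
-/

noncomputable section

namespace Summit.QuantumFields.BalabanUV.T4Continuum.NE1p.DressedSmallFieldInnerLabelsRefinedWitness

open Set Metric MeasureTheory Complex
open scoped BigOperators
open Literature.MathematicalPhysics.QuantumFieldTheory.Balaban1983to89
open Literature.MathematicalPhysics.QuantumFieldTheory.Balaban1983to89.B12TreeDecay (K₀ K₀_pos)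
open Literature.MathematicalPhysics.QuantumFieldTheory.Balaban1983to89.B13Resummation (locE)
open Literature.MathematicalPhysics.QuantumFieldTheory.Balaban1983to89.B13FamilySum (coveringFamilies mem_coveringFamilies)
open Literature.MathematicalPhysics.QuantumFieldTheory.Balaban1983to89.TreeLengthTorus (TPt TDom tsys torusTreeLen torusTreeLen_singleton
  torusTreeLen_nonneg)
open Literature.MathematicalPhysics.QuantumFieldTheory.Balaban1983to89.TreeLengthTorusGeometry (tgeometry TTouch)
open Summit.QuantumFields.BalabanUV.T4Continuum.B13HistMeasurable (B13HistM)
open Summit.QuantumFields.BalabanUV.T4Continuum.B13HistWitness (toyFrame)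
open Summit.QuantumFields.BalabanUV.T4Continuum.B13TermParamGaussianBi (BiCore)
open Summit.QuantumFields.BalabanUV.T4Continuum.TorusBlockRefinement (trefineDom trefineDom_val)
open Summit.QuantumFields.BalabanUV.T4Continuum.TorusBlockRefinementCard (torusTreeLen_lt_trefine_singleton torusTreeLen_trefine_singleton_ge
  card_trefine_singleton)
open Summit.QuantumFields.BalabanUV.T4Continuum.NE1p.DressedSmallFieldTorusWitness (X₀ X₀_val eq_X₀_iff hrate_torus_num dressedConst_le_one
  exp_locE_cube)
open Summit.QuantumFields.BalabanUV.T4Continuum.NE1p.DressedSmallFieldGeometry (torus_consts)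
open Summit.QuantumFields.BalabanUV.T4Continuum.NE1p.DressedSmallFieldGeometryFaces (K₀_four)
open Summit.QuantumFields.BalabanUV.T4Continuum.NE1p.DressedSmallFieldCoresWitness (E1 crd liveTable norm_liveTable_le coreW N₁_coreW ctr0
  hroom0 Acst Acst_pos incr integral_incr_pos)
open Summit.QuantumFields.BalabanUV.T4Continuum.NE1p.DressedSmallFieldCoresMassWitness (letterMass_coreW cM cM_pos)
open Summit.QuantumFields.BalabanUV.T4Continuum.NE1p.DressedSmallFieldDepCoresWitness (budget_half termAt_coreW_pencil closedForm_real_sub_zero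
  norm_term_le)
open Summit.QuantumFields.BalabanUV.T4Continuum.NE1p.DressedSmallFieldFamiliesWitness (δF κF α₆F α₆F_pos α₆F_le_one δF_mul_κF_pos hκ_F h229_F)
open Summit.QuantumFields.BalabanUV.T4Continuum.NE1p.DressedSmallFieldInnerLabelsRefined (attachedPart_locE_le_of_coresAt_pencil_innerLabels_refined)
open Summit.QuantumFields.BalabanUV.T4Continuum.NE1p.DressedSmallFieldNestedToriWitness (hsmall_N)

section Torus
variable (N : ℕ) [NeZero N] (L : ℕ) [NeZero L]

/-! ## §1 OUR located numerals and S48's located clauses -/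

/-- THE COUNT RATE (toy numeral, S48's located letter): `RR := 2·(64 log 162) + 3` — one unit above the per-polymer rate
`2·(64 log 162) + 2` of W24's `hrate_torus_num`. [folklore] -/
def RR : ℝ := 2 * (64 * Real.log 162) + 3

/-- THE BOND LETTER (toy numeral): `sR := e^{−(5RR+1)}∕64`, so that `64·(e^{5RR}·sR·e^{1·1}) = 1`. [folklore] -/
def sR : ℝ := Real.exp (-(RR * 5 + 1)) / 64

/-- `log 162 > 0`. [arith] -/
theorem log162_pos : 0 < Real.log 162 := Real.log_pos (by norm_num)

/-- `0 < RR`. [arith] -/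
theorem RR_pos : 0 < RR := by unfold RR; have := log162_pos; positivity

/-- `0 < sR`. [arith] -/
theorem sR_pos : 0 < sR := by unfold sR; positivity

/-- `sR ≤ 1`. [arith] -/
theorem sR_le_one : sR ≤ 1 := by
  unfold sR
  have h : Real.exp (-(RR * 5 + 1)) ≤ 1 := Real.exp_le_one_iff.2 (by linarith [RR_pos])
  linarith

/-- **N0u's RATE BOOKKEEPING WITH EQUALITY** at the located letters: `RR − 64·(e^{RR·5}·sR·e^{1·1}) = 2·(64 log 162) + 2`. [arith] -/
theorem hRR_R_eq : RR - 64 * (Real.exp (RR * 5) * sR * Real.exp (1 * 1)) = 2 * (64 * Real.log 162) + 2 := by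
  unfold sR
  have h : Real.exp (RR * 5) * Real.exp (-(RR * 5 + 1)) * Real.exp (1 * 1) = 1 := by
    rw [← Real.exp_add, ← Real.exp_add, show RR * 5 + -(RR * 5 + 1) + 1 * 1 = 0 by ring, Real.exp_zero]
  have h' : 64 * (Real.exp (RR * 5) * (Real.exp (-(RR * 5 + 1)) / 64) * Real.exp (1 * 1)) = 1 := by
    rw [show 64 * (Real.exp (RR * 5) * (Real.exp (-(RR * 5 + 1)) / 64) * Real.exp (1 * 1)) =
      Real.exp (RR * 5) * Real.exp (-(RR * 5 + 1)) * Real.exp (1 * 1) by ring, h]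
  rw [h']; unfold RR; ring

/-- … S48's binder `hRR : Rkp ≤ R − 64·(e^{R·5}·s·e^{b₀t})` at `(Rkp, R, s, b₀, t) = (2·(64 log 162)+2, RR, sR, 1, 1)`. [arith] -/
theorem hRR_R : 2 * (64 * Real.log 162) + 2 ≤ RR - 64 * (Real.exp (RR * 5) * sR * Real.exp (1 * 1)) := hRR_R_eq.ge

/-- S48's located (2.29)-rate clause `64·log 162 + 1 ≤ δκ` — W45's `hκ_F` BY NAME, moved by pv22's `torus_consts`. [arith] -/
theorem hκ_R : 64 * Real.log 162 + 1 ≤ δF * κF := by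
  have h := hκ_F 1; rwa [(torus_consts 1).2.1] at h

/-! S48's located (2.29)-amplitude clause `e·K₀(64,8)·64·α₆ ≤ 1` is W45's `h229_F` moved by `K₀_four`∕`torus_consts` — the same statement is
W69's `DressedSmallFieldComponentInnerNestedToriWitness.h229k_I` (landed minutes before this file); it is supplied INLINE at the END call below from
`h229_F 1` (no declaration of ours, no extra import for one arithmetic line). -/

/-! S48's located smallness clause at `(A₀, ϱ, A₁, r₁) = (0, 2, A∕4, 0)` — `(0 + 2·(A∕4))·e^{5·0+1}·K₀(64,8)·9·64 = ½ ≤ 1` — IS W59's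
`DressedSmallFieldNestedToriWitness.hsmall_N` (leaf-10 g11), used BY NAME below (no restatement). -/

/-! ## §2 THE DATUM: the refined unit block of the fine torus, ONE covered inner label on it -/

/-- THE REFINED UNIT BLOCK (toy DATA): `blk := trefineDom L N X₀` — the `L⁴` fine cubes of the coarse unit cube, ONE localization
domain of the FINE torus (S43.1's `trefineDom` BY NAME). [folklore] -/
def blk : TDom 4 (L * N) := trefineDom L N (X₀ N)

/-- Its cubes are `trefine L N {0}`. [folklore] -/
theorem blk_val : (blk N L).1 = TorusBlockRefinement.trefine L N {0} := by
  unfold blk; rw [trefineDom_val, X₀_val]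

/-- It has `L⁴` cubes (S47's `card_trefine_singleton` BY NAME). [folklore] -/
theorem card_blk : (blk N L).1.card = L ^ 4 := by rw [blk_val]; exact card_trefine_singleton (L := L) (N' := N) 0

/-- THE INNER-LABEL TYPE OF THE FINE TORUS (abbreviation): `⟨W, (𝐃, P)⟩`, bonds read as cubes. [folklore] -/
abbrev LabelR : Type := Σ _ : Finset (TPt 4 (L * N)), Finset (TDom 4 (L * N)) × Finset (TPt 4 (L * N))

/-- THE ONE LABEL (toy DATA): `lab := ⟨∅, ({blk}, ∅)⟩` — no uncovered fine cube, the refined block covered by ITSELF, no bond. [folklore] -/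
def lab : LabelR N L := ⟨∅, ({blk N L}, ∅)⟩

open Classical in
/-- THE TERM INDEXING (toy DATA): the one label at the coarse unit cube, nothing elsewhere. [folklore] -/
def termsR (Z : TDom 4 N) : Finset (LabelR N L) := if Z = X₀ N then {lab N L} else ∅

open Classical in
/-- The terms of `X₀`. [folklore] -/
theorem termsR_X₀ : termsR N L (X₀ N) = {lab N L} := by unfold termsR; rw [if_pos rfl]

open Classical in
/-- **S48's `hadm` MET**: `W = ∅ ⊆ blk.1`; the singleton family `{blk}` covers the refined footprint `blk.1 ∖ ∅` (`mem_coveringFamilies`: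
`{blk} ⊆ univ`, `⋃ = blk.1`); `P = ∅ ⊆ bondsOf ∅`; `#∅ ≤ 2·#∅`. [folklore] -/
theorem hadm_R : ∀ Z : (tsys 4 N).Dom, ∀ l ∈ termsR N L Z, l.1 ⊆ (trefineDom L N Z).1 ∧
    l.2.1 ∈ coveringFamilies Finset.univ (fun Y : (tsys 4 (L * N)).Dom => Y.1) ((trefineDom L N Z).1 \ l.1) ∧
      l.2.2 ⊆ (fun W : Finset (TPt 4 (L * N)) => W) l.1 ∧ l.1.card ≤ 2 * l.2.2.card := by
  intro Z l hl
  unfold termsR at hl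
  split_ifs at hl with hZ
  · rw [Finset.mem_singleton] at hl
    subst hl; subst hZ
    refine ⟨Finset.empty_subset _, ?_, Finset.empty_subset _, by simp [lab]⟩
    show ({blk N L} : Finset (TDom 4 (L * N))) ∈ coveringFamilies Finset.univ (fun Y : TDom 4 (L * N) => Y.1)
      ((trefineDom L N (X₀ N)).1 \ ∅)
    rw [mem_coveringFamilies, Finset.sdiff_empty, Finset.singleton_biUnion]
    exact ⟨Finset.subset_univ _, rfl⟩
  · exact absurd hl (Finset.notMem_empty l)

/-! ## §3 THE LABEL-INDEXED CORES (toy DATA): W33's one-label core weighted by S48's majorant -/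

/-- S48's table-blind majorant of a label (toy DATA): `(Π_{Y∈𝐃} α₆F·e^{−δFκF·d(Y)}·e^{−RR(d(Y)+5)})·(sR²·1)^{#P}` — LITERALLY the
shape in S48's `hAmp` at our letters. [folklore] -/
def majR (l : LabelR N L) : ℝ :=
  (∏ Y ∈ l.2.1, (α₆F * Real.exp (-(δF * κF * torusTreeLen Y.1)) * Real.exp (-(RR * (torusTreeLen Y.1 + 5))))) *
    (sR ^ 2 * 1) ^ l.2.2.card

/-- `0 < majR l`. [arith] -/
theorem majR_pos (l : LabelR N L) : 0 < majR N L l := by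
  unfold majR
  refine mul_pos (Finset.prod_pos fun Y _ => by have := α₆F_pos; positivity) (pow_pos (by have := sR_pos; positivity) _)

/-- **THE DATUM's MAJORANT**: `majR lab = α₆F·e^{−δFκF·d_B}·e^{−RR(d_B+5)}`, `d_B := torusTreeLen blk.1` — the FINE tree length of the
refined block enters. [folklore] -/
theorem majR_lab : majR N L (lab N L) =
    α₆F * Real.exp (-(δF * κF * torusTreeLen (blk N L).1)) * Real.exp (-(RR * (torusTreeLen (blk N L).1 + 5))) := by
  unfold majR lab
  simp only [Finset.prod_singleton, Finset.card_empty, pow_zero, mul_one]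

/-- `majR l ≤ 1` for the datum's label (every factor `≤ 1`). [arith] -/
theorem majR_lab_le_one : majR N L (lab N L) ≤ 1 := by
  rw [majR_lab]
  have hd := torusTreeLen_nonneg (blk N L).1
  have h1 : Real.exp (-(δF * κF * torusTreeLen (blk N L).1)) ≤ 1 :=
    Real.exp_le_one_iff.2 (neg_nonpos.2 (mul_nonneg δF_mul_κF_pos.le hd))
  have h2 : Real.exp (-(RR * (torusTreeLen (blk N L).1 + 5))) ≤ 1 :=
    Real.exp_le_one_iff.2 (neg_nonpos.2 (by have := RR_pos; positivity))
  exact mul_le_one₀ (mul_le_one₀ α₆F_le_one (Real.exp_pos _).le h1) (Real.exp_pos _).le h2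

variable (r : ℝ) (hr : 0 ≤ r)

/-- THE LABEL-DEPENDENT CAUCHY WEIGHT (toy DATA): `cR l := (cM r∕2)·majR l` (W35's `cM` BY NAME). [folklore] -/
def cR (l : LabelR N L) : ℝ := cM r / 2 * majR N L l

/-- `0 < cR l`. [arith] -/
theorem cR_pos (l : LabelR N L) : 0 < cR N L r l := mul_pos (half_pos (cM_pos r)) (majR_pos N L l)

/-- **THE LABEL-INDEXED CORE FAMILY** (toy DATA): W33's one-label core `coreW` (BY NAME) at the weight `cR l`. [folklore] -/
def GR : ∀ (_ : ℕ) (_ : LabelR N L), ℕ → BiCore toyFrame (fun _ : Unit => (0 : ℕ)) ℂ Unit E1 :=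
  fun _ l _ => coreW (cR N L r l) r hr

/-- The core at `(k, l, X)`. [folklore] -/
@[simp] theorem GR_apply (k : ℕ) (l : LabelR N L) (X : ℕ) : GR N L r hr k l X = coreW (cR N L r l) r hr := rfl

open Classical in
/-- THE ACTIVITY OF RECORD (toy DATA): the sum of the label-indexed cores' terms over `termsR Z` along the pencil `s ↦ 0 + s • liveTable`
(S48's `hact`∕`hscale` by `rfl`, `emb Z := k`). [folklore] -/
def actR (k : ℕ) (s : ℂ) (Z : TDom 4 N) : ℂ :=
  ∑ l ∈ termsR N L Z, (GR N L r hr k l k).termAt (0 : ℂ) ((0 : B13HistM toyFrame) + s • liveTable)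

open Classical in
/-- **`hAmp` MET** [decided toy], in the LITERAL binder shape of S48 at NE5's toy letters `(mq, bq, N₀) = (1, 0, 1)`, `ϱ = 2`, `A₀ = 0`,
`A₁ = A∕4`: `majR l·|cM r∕2|·√(2π)·e^{r·2‖liveTable‖} ≤ (0 + 2·(A∕4))·majR l` (W35's `letterMass_coreW`, W41's `budget_half` BY NAME). [folklore] -/
theorem hAmp_R (k : ℕ) :
    ∀ Z : (tsys 4 N).Dom, Z.1 ⊆ (X₀ N).1 → ∀ l ∈ termsR N L Z,
      (GR N L r hr k l k).lam.real univ *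
          ((GR N L r hr k l k).wB * (fun (_ : ℕ) (_ : LabelR N L) (_ : ℕ) => (1 : ℝ)) k l k *
            Real.exp ((fun (_ : ℕ) (_ : LabelR N L) (_ : ℕ) => (0 : ℝ)) k l k)) *
          (Real.pi / ((fun (_ : ℕ) (_ : LabelR N L) (_ : ℕ) => (1 : ℝ)) k l k / 2)) ^ (Module.finrank ℝ E1 / 2 : ℝ) *
        Real.exp ((GR N L r hr k l k).N₁ * (‖(0 : B13HistM toyFrame)‖ + 2 * ‖liveTable‖)) ≤
      (0 + 2 * (Acst / 4)) * ((∏ Y ∈ l.2.1, (α₆F * Real.exp (-(δF * κF * torusTreeLen Y.1)) *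
        Real.exp (-(RR * (torusTreeLen Y.1 + 5))))) * (sR ^ 2 * 1) ^ l.2.2.card) := by
  intro Z _ l _
  simp only [GR_apply]
  rw [letterMass_coreW, N₁_coreW, norm_zero, zero_add]
  have hp : 0 ≤ majR N L l := (majR_pos N L l).le
  have hT : 2 * ‖liveTable‖ ≤ 2 := by linarith [norm_liveTable_le]
  have hb := budget_half r hr hT
  show |cR N L r l| * Real.sqrt (2 * Real.pi) * Real.exp (r * (2 * ‖liveTable‖)) ≤ (0 + 2 * (Acst / 4)) * majR N L l
  unfold cR
  rw [abs_mul, abs_of_nonneg hp]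
  calc |cM r / 2| * majR N L l * Real.sqrt (2 * Real.pi) * Real.exp (r * (2 * ‖liveTable‖))
      = majR N L l * (|cM r / 2| * Real.sqrt (2 * Real.pi) * Real.exp (r * (2 * ‖liveTable‖))) := by ring
    _ ≤ majR N L l * (Acst / 2) := mul_le_mul_of_nonneg_left hb hp
    _ = (0 + 2 * (Acst / 4)) * majR N L l := by ring

/-! ## §4 THE JUNCTION FIRES: S48's END applied ONCE BY NAME (a decided applier) -/

open Classical in
/-- **S48's `attachedPart_locE_le_of_coresAt_pencil_innerLabels_refined` FIRES** [decided toy]: the nested tori `(N, L·N)` (every `N`,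
`L`), cores `GR` indexed by inner labels of the REFINED footprints, W33's `ctr0`∕`hroom0`, NE5's toy letters INLINE, the pencil's two radius
inequalities, `hscale`∕`hact` by `rfl`, `(A₀, A₁, Rkp, r₁) := (0, A∕4, 2·(64 log 162)+2, 0)` with W24's `hrate_torus_num`, W59's `hsmall_N`,
bonds READ AS CUBES (`bondsOf := id`, `b₀ := 1`), `(δ, κ, α₆, R, s, t) := (δF, κF, α₆F, RR, sR, 1)` with `hκ_R`∕`h229_F` (inline)∕`hRR_R`, `hadm_R`,
`hAmp_R`, `hϱ : 2 ≤ 2`, `hϱA`.  Conclusion LITERAL. [folklore] -/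
theorem junctionEnd_fires (k : ℕ) :
    ‖locE (TTouch (d := 4) (N := N)) (fun Z : (tsys 4 N).Dom => Z.1) (actR N L r hr k 1) (X₀ N).1 -
        locE (TTouch (d := 4) (N := N)) (fun Z : (tsys 4 N).Dom => Z.1) (actR N L r hr k 0) (X₀ N).1‖ ≤
      4 * (Real.exp 1 * 9 * 64 * K₀ 64 8 ^ 2) * (Acst / 4) * Real.exp (-(0 * torusTreeLen (X₀ N).1)) :=
  attachedPart_locE_le_of_coresAt_pencil_innerLabels_refined (N := N) (L := L) (GR N L r hr)
    (Win := Set.univ) (ctr := ctr0) (ROp := fun _ => 1) (RHist := fun _ => 2) (R' := fun _ => 2)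
    (mq := fun _ _ _ => 1) (bq := fun _ _ _ => 0) (N₀ := fun _ _ _ => 1)
    hroom0 (fun _ _ _ _ _ _ _ => one_pos)
    (fun _ _ _ _ _ _ _ => ⟨fun _ _ => aestronglyMeasurable_const, fun _ => differentiableOn_const _, fun _ _ _ => by
      show ‖(1 : ℂ)‖ ≤ 1; rw [norm_one]⟩)
    (fun _ _ _ _ _ _ _ => ⟨fun _ _ => (Complex.measurable_ofReal.comp (measurable_snd.norm.pow_const 2)).aestronglyMeasurable,
      fun _ _ => differentiableOn_const _, fun _ _ _ v => by
        show 1 * ‖v‖ ^ 2 - 0 ≤ (((‖v‖ ^ 2 : ℝ) : ℂ)).re; rw [Complex.ofReal_re]; simp⟩)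
    (g := fun _ => 0) (Set.mem_univ _) (U := ()) (o := 0) (h₀ := 0) (w := liveTable) (ϱ := 2)
    (by show ‖(0 : ℂ) - 0‖ ≤ 1; simp)
    (by show ‖(0 : B13HistM toyFrame) - 0‖ + 2 * ‖liveTable‖ ≤ 2; rw [sub_zero, norm_zero, zero_add];
        linarith [norm_liveTable_le])
    (emb := fun _ => k) (fun _ => rfl) (terms := termsR N L) (act := actR N L r hr k) (fun _ _ _ => rfl)
    (A₀ := 0) (A₁ := Acst / 4) (Rkp := 2 * (64 * Real.log 162) + 2) (r₁ := 0) (X₀ N)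
    le_rfl (by have := Acst_pos; positivity) le_rfl hrate_torus_num hsmall_N
    (fun W => W) (δ := δF) (κ := κF) (α₆ := α₆F) (R := RR) (b₀ := 1) (s := sR) (t := 1) α₆F_pos.le hκ_R
    (by have h := h229_F 1; rwa [K₀_four, (torus_consts 1).2.2] at h)
    sR_pos.le sR_le_one zero_le_one (fun W => by rw [one_mul]) hRR_R (hadm_R N L) (hAmp_R N L r hr k) le_rfl
    (by have := Acst_pos; linarith)

open Classical in
/-- … in CLOSED FORM: `≤ 4·(e·9·64·K₀(64,8)²)·(A∕4)·1 = K₀(64,8)` (W33's `Acst` unfolded; decay factor `1` at `r₁ = 0`). [folklore] -/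
theorem junctionEnd_fires_closed (k : ℕ) :
    ‖locE (TTouch (d := 4) (N := N)) (fun Z : (tsys 4 N).Dom => Z.1) (actR N L r hr k 1) (X₀ N).1 -
        locE (TTouch (d := 4) (N := N)) (fun Z : (tsys 4 N).Dom => Z.1) (actR N L r hr k 0) (X₀ N).1‖ ≤ K₀ 64 8 := by
  refine (junctionEnd_fires N L r hr k).trans (le_of_eq ?_)
  rw [zero_mul, neg_zero, Real.exp_zero, mul_one]
  unfold Acst
  have hK := K₀_pos (64 : ℝ) 8
  have he := Real.exp_pos 1
  field_simp

end Torus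

end Summit.QuantumFields.BalabanUV.T4Continuum.NE1p.DressedSmallFieldInnerLabelsRefinedWitness

end
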